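import Summits.CriticalPhenomena.PercolationContinuityZ3.Theorems.PercNearOneGluingNoHeavyLowerTailKNGoodGCThreeHair
import HarnessLib

/-!
# The hair inequalities HI2 / HI3 of GC₃ for ANY NUMBER of pendant stars (`NoHeavyLowerTail` cell, stmt-CriticalPhenomena-4575;
# prover `prim-hp-2`, gen 14) — arithmetic tool file for "GC₃ with `m` stars" (memo MEMO-gen14 §7)

Support file (`--supports stmt-CriticalPhenomena-4575`).  No definitions, no named facts, no sorries; pure real arithmetic.

In the three-relay gluing inequality GC₃ (`KNGoodGC3.gc_threeRelays`, memo MEMO-gen12 §2) the core enters through five world weights and the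
two stars `x, y` through the HAIR INEQUALITIES `(1−H₃)·q₁₃ ≤ H₁H₃·q_d` (HI2, `KNGoodGC3.hairIneq_middle`) and `(1−H₁H₂)·q₁₂ ≤ H₁H₂·q_d` (HI3,
`KNGoodGC3.hairIneq_top`).  For `m` independent pendant stars with hair probabilities `x^i_a` (`i ∈ s`, `a ∈ {1,2,3}`) the same quantities are
`H_a = 1 − ∏_i (1 − x^i_a)`, `q_d = ∏_i α_i` (`α_i` = probability that star `i` has at most one hair), `q₁₃ = ∏_i (α_i + X^i₁₃) − ∏_i α_i`
(`X^i₁₃ = x^i₁(1−x^i₂)x^i₃`; "every star hangs inside one of `∅,{1},{2},{3},{1,3}` and some star on `{1,3}`"), `q₁₂` likewise, and the target's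
closed forms see only the merged `H`.  This file proves HI2 and HI3 for every finite family of stars:

* `KNGoodGC3Multi.one_sub_prod_doubleHit_le` — `1 − ∏(1 − a_i b_i) ≤ (1 − ∏(1−a_i))·(1 − ∏(1−b_i))` on `[0,1]` ("some star hits both ports"
  is at most "the merged star hits both ports"; induction on the family).
* `KNGoodGC3Multi.prod_absorb_le` — the abstract absorption lemma: from per-star bounds `u_i(α_i + X_i) ≤ α_i`, `u_i X_i ≤ v_i α_i`, `u_i ≤ 1 − v_i`
  one gets `(∏u_i)·(∏(α_i+X_i) − ∏α_i) ≤ (∏α_i)·(1 − ∏(1−v_i))` (induction; the telescoping of memo §7(c)).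
* `KNGoodGC3Multi.hairIneq_middle_multi` (HI2 for `m` stars), `KNGoodGC3Multi.hairIneq_top_multi` (HI3 for `m` stars), and the degeneracy bounds
  `KNGoodGC3Multi.noHit23_le_qd_multi` (`(1−H₂)(1−H₃) ≤ q_d`), `KNGoodGC3Multi.noHit3_le_qd_add_q12_multi` (`1−H₃ ≤ ∏(α_i + X^i₁₂) = q_d + q₁₂`) —
  exactly the hypotheses `hair`, `hdeg` of `KNGoodGC3.gc3_middle_arith` / `gc3_top_arith` with the `m`-star weights.
The per-star facts are gen 12's `absorb13_le_alpha`, `absorb12_le_alpha`, `noHit_le_alpha`, `noHit3_le_alpha`.  Numerics (lab/himulti.py): `m = 2..5`,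
11 000 random families, 0 violations.  Use: the m-star GC₃ (observer with any number of pendant-star children at `|A| = 3`, memo §7) — the world
expansion of the loneliness row and the m-star merged-star lemma are the remaining Lean steps.
[cite: KozmaNitzan2024, §3.2 Definition and Thm. 5 (pp. 12–14) — extension to several pendant stars, three relays]
-/

noncomputable section

namespace Summit.CriticalPhenomena.PercolationContinuityZ3.Theorems

open scoped BigOperators

namespace KNGoodGC3Multi

open KNGoodGC3 Finset

variable {ι : Type*}

/-- A product of factors in `[0,1]` lies in `[0,1]`. [folklore] -/
theorem prod_mem_unit (s : Finset ι) (f : ι → ℝ) (h0 : ∀ i ∈ s, 0 ≤ f i) (h1 : ∀ i ∈ s, f i ≤ 1) :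
    0 ≤ ∏ i ∈ s, f i ∧ ∏ i ∈ s, f i ≤ 1 :=
  ⟨Finset.prod_nonneg h0, Finset.prod_le_one h0 h1⟩

/-- **"Some star hits both ports" ≤ "the merged star hits both ports".**  For `a_i, b_i ∈ [0,1]`:
`1 − ∏_i (1 − a_i b_i) ≤ (1 − ∏_i (1 − a_i))·(1 − ∏_i (1 − b_i))`. [folklore] -/
theorem one_sub_prod_doubleHit_le [DecidableEq ι] (s : Finset ι) (a b : ι → ℝ)
    (ha : ∀ i ∈ s, 0 ≤ a i ∧ a i ≤ 1) (hb : ∀ i ∈ s, 0 ≤ b i ∧ b i ≤ 1) :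
    1 - ∏ i ∈ s, (1 - a i * b i) ≤ (1 - ∏ i ∈ s, (1 - a i)) * (1 - ∏ i ∈ s, (1 - b i)) := by
  induction s using Finset.induction_on with
  | empty => simp
  | @insert j s hj ih =>
    have ha' : ∀ i ∈ s, 0 ≤ a i ∧ a i ≤ 1 := fun i hi => ha i (Finset.mem_insert_of_mem hi)
    have hb' : ∀ i ∈ s, 0 ≤ b i ∧ b i ≤ 1 := fun i hi => hb i (Finset.mem_insert_of_mem hi)
    have IH := ih ha' hb'
    obtain ⟨hA0, hA1⟩ := prod_mem_unit s (fun i => 1 - a i) (fun i hi => by linarith [(ha' i hi).2]) (fun i hi => by linarith [(ha' i hi).1])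
    obtain ⟨hB0, hB1⟩ := prod_mem_unit s (fun i => 1 - b i) (fun i hi => by linarith [(hb' i hi).2]) (fun i hi => by linarith [(hb' i hi).1])
    obtain ⟨hL0, hL1⟩ := prod_mem_unit s (fun i => 1 - a i * b i)
      (fun i hi => by nlinarith [(ha' i hi).1, (ha' i hi).2, (hb' i hi).1, (hb' i hi).2])
      (fun i hi => by nlinarith [(ha' i hi).1, (hb' i hi).1])
    obtain ⟨hja0, hja1⟩ := ha j (Finset.mem_insert_self j s)
    obtain ⟨hjb0, hjb1⟩ := hb j (Finset.mem_insert_self j s)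
    rw [Finset.prod_insert hj, Finset.prod_insert hj, Finset.prod_insert hj]
    set F := ∏ i ∈ s, (1 - a i) with hF
    set G := ∏ i ∈ s, (1 - b i) with hG
    set L := ∏ i ∈ s, (1 - a i * b i) with hL
    -- `1 − (1−ab)L ≤ (1 − (1−a)F)(1 − (1−b)G)` from `1 − L ≤ (1−F)(1−G)`
    nlinarith [IH, mul_nonneg hja0 hjb0, mul_nonneg (mul_nonneg hja0 hjb0) hL0, mul_nonneg hja0 (sub_nonneg.2 hjb1),
      mul_nonneg hjb0 (sub_nonneg.2 hja1), mul_nonneg (mul_nonneg hja0 (sub_nonneg.2 hjb1)) hA0,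
      mul_nonneg (mul_nonneg hjb0 (sub_nonneg.2 hja1)) hB0, mul_nonneg (mul_nonneg hja0 (sub_nonneg.2 hjb1)) (mul_nonneg hA0 (sub_nonneg.2 hB1)),
      mul_nonneg (mul_nonneg hjb0 (sub_nonneg.2 hja1)) (mul_nonneg hB0 (sub_nonneg.2 hA1)),
      mul_nonneg (mul_nonneg hja0 hjb0) (sub_nonneg.2 IH)]

/-- **Abstract absorption lemma** (the telescoping of memo §7(c)).  Per index: `α_i, X_i, v_i ≥ 0`, `0 ≤ u_i ≤ 1 − v_i`,
`u_i(α_i + X_i) ≤ α_i` and `u_i X_i ≤ v_i α_i`.  Then `(∏u_i)·(∏(α_i + X_i) − ∏α_i) ≤ (∏α_i)·(1 − ∏(1 − v_i))`. [folklore] -/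
theorem prod_absorb_le [DecidableEq ι] (s : Finset ι) (α X u v : ι → ℝ)
    (hα : ∀ i ∈ s, 0 ≤ α i) (hX : ∀ i ∈ s, 0 ≤ X i) (hu : ∀ i ∈ s, 0 ≤ u i) (hv : ∀ i ∈ s, 0 ≤ v i)
    (huv : ∀ i ∈ s, u i ≤ 1 - v i) (hA : ∀ i ∈ s, u i * (α i + X i) ≤ α i) (hB : ∀ i ∈ s, u i * X i ≤ v i * α i) :
    (∏ i ∈ s, u i) * (∏ i ∈ s, (α i + X i) - ∏ i ∈ s, α i) ≤ (∏ i ∈ s, α i) * (1 - ∏ i ∈ s, (1 - v i)) := by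
  induction s using Finset.induction_on with
  | empty => simp
  | @insert j s hj ih =>
    have r : ∀ {P : ι → Prop}, (∀ i ∈ insert j s, P i) → ∀ i ∈ s, P i := fun h i hi => h i (Finset.mem_insert_of_mem hi)
    have IH := ih (r hα) (r hX) (r hu) (r hv) (r huv) (r hA) (r hB)
    have mj := Finset.mem_insert_self j s
    have hαj := hα j mj; have hXj := hX j mj; have huj := hu j mj; have hvj := hv j mj
    have huvj := huv j mj; have hAj := hA j mj; have hBj := hB j mj
    -- products over `s`
    have hD0 : 0 ≤ ∏ i ∈ s, α i := Finset.prod_nonneg (r hα)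
    have hU0 : 0 ≤ ∏ i ∈ s, u i := Finset.prod_nonneg (r hu)
    obtain ⟨hM0, hM1⟩ := prod_mem_unit s (fun i => 1 - v i) (fun i hi => by linarith [(r huv) i hi, (r hu) i hi])
      (fun i hi => by linarith [(r hv) i hi])
    have hED : ∏ i ∈ s, α i ≤ ∏ i ∈ s, (α i + X i) :=
      Finset.prod_le_prod (r hα) fun i hi => by linarith [(r hX) i hi]
    -- `(∏u)(∏(α+X)) ≤ ∏α` termwise
    have hUE : (∏ i ∈ s, u i) * ∏ i ∈ s, (α i + X i) ≤ ∏ i ∈ s, α i := by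
      rw [← Finset.prod_mul_distrib]
      exact Finset.prod_le_prod (fun i hi => mul_nonneg ((r hu) i hi) (by linarith [(r hα) i hi, (r hX) i hi])) fun i hi => (r hA) i hi
    rw [Finset.prod_insert hj, Finset.prod_insert hj, Finset.prod_insert hj, Finset.prod_insert hj]
    set U := ∏ i ∈ s, u i
    set E := ∏ i ∈ s, (α i + X i)
    set D := ∏ i ∈ s, α i
    set M := ∏ i ∈ s, (1 - v i)
    -- `u U ((α+X)E − αD) = α·u·U(E−D) + (uX)·(UE) ≤ α u D(1−M) + v α D ≤ αD(1 − (1−v)M)`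
    have h1 : u j * (U * (E - D)) ≤ u j * (D * (1 - M)) := mul_le_mul_of_nonneg_left IH huj
    have h2 : u j * X j * (U * E) ≤ v j * α j * D :=
      mul_le_mul hBj hUE (mul_nonneg hU0 (hD0.trans hED)) (mul_nonneg hvj hαj)
    have h3 : u j * (1 - M) ≤ (1 - v j) * (1 - M) := mul_le_mul_of_nonneg_right huvj (by linarith)
    have e : u j * U * ((α j + X j) * E - α j * D) = α j * (u j * (U * (E - D))) + u j * X j * (U * E) := by ring
    rw [e]
    nlinarith [mul_le_mul_of_nonneg_left h1 hαj, h2, mul_le_mul_of_nonneg_left h3 (mul_nonneg hαj hD0)]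

/-- **HI2 for any number of stars**: with `α_i` = P(star `i` has at most one hair), `X^i₁₃ = x^i₁(1−x^i₂)x^i₃`, `1 − H_a = ∏_i(1 − x^i_a)`:
`(1−H₃)·(∏(α_i + X^i₁₃) − ∏α_i) ≤ H₁H₃·∏α_i`, i.e. `(1−H₃)q₁₃ ≤ H₁H₃ q_d` for the m-star world weights.
[cite: KozmaNitzan2024, §3.2 (pp. 12–14) — extension; folklore arithmetic] -/
theorem hairIneq_middle_multi [DecidableEq ι] (s : Finset ι) (x₁ x₂ x₃ : ι → ℝ)
    (h₁ : ∀ i ∈ s, 0 ≤ x₁ i ∧ x₁ i ≤ 1) (h₂ : ∀ i ∈ s, 0 ≤ x₂ i ∧ x₂ i ≤ 1) (h₃ : ∀ i ∈ s, 0 ≤ x₃ i ∧ x₃ i ≤ 1) :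
    (∏ i ∈ s, (1 - x₃ i)) *
        (∏ i ∈ s, ((1 - x₁ i) * (1 - x₂ i) * (1 - x₃ i) + x₁ i * (1 - x₂ i) * (1 - x₃ i) + (1 - x₁ i) * x₂ i * (1 - x₃ i) +
              (1 - x₁ i) * (1 - x₂ i) * x₃ i + x₁ i * (1 - x₂ i) * x₃ i) -
          ∏ i ∈ s, ((1 - x₁ i) * (1 - x₂ i) * (1 - x₃ i) + x₁ i * (1 - x₂ i) * (1 - x₃ i) + (1 - x₁ i) * x₂ i * (1 - x₃ i) +
              (1 - x₁ i) * (1 - x₂ i) * x₃ i)) ≤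
      (1 - ∏ i ∈ s, (1 - x₁ i)) * (1 - ∏ i ∈ s, (1 - x₃ i)) *
        ∏ i ∈ s, ((1 - x₁ i) * (1 - x₂ i) * (1 - x₃ i) + x₁ i * (1 - x₂ i) * (1 - x₃ i) + (1 - x₁ i) * x₂ i * (1 - x₃ i) +
            (1 - x₁ i) * (1 - x₂ i) * x₃ i) := by
  set α : ι → ℝ := fun i => (1 - x₁ i) * (1 - x₂ i) * (1 - x₃ i) + x₁ i * (1 - x₂ i) * (1 - x₃ i) + (1 - x₁ i) * x₂ i * (1 - x₃ i) +
    (1 - x₁ i) * (1 - x₂ i) * x₃ i with hαdef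
  set X : ι → ℝ := fun i => x₁ i * (1 - x₂ i) * x₃ i with hXdef
  have hα : ∀ i ∈ s, 0 ≤ α i := fun i hi =>
    alpha_nonneg (h₁ i hi).1 (h₁ i hi).2 (h₂ i hi).1 (h₂ i hi).2 (h₃ i hi).1 (h₃ i hi).2
  have hX : ∀ i ∈ s, 0 ≤ X i := fun i hi => mul_nonneg (mul_nonneg (h₁ i hi).1 (by linarith [(h₂ i hi).2])) (h₃ i hi).1
  have key := prod_absorb_le s α X (fun i => 1 - x₃ i) (fun i => x₁ i * x₃ i) hα hX
    (fun i hi => by linarith [(h₃ i hi).2]) (fun i hi => mul_nonneg (h₁ i hi).1 (h₃ i hi).1)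
    (fun i hi => by nlinarith [(h₁ i hi).2, (h₃ i hi).1])
    (fun i hi => absorb13_le_alpha (h₁ i hi).1 (h₁ i hi).2 (h₂ i hi).1 (h₂ i hi).2 (h₃ i hi).1 (h₃ i hi).2)
    (fun i hi => by
      have hn := noHit_le_alpha (h₁ i hi).1 (h₁ i hi).2 (h₂ i hi).1 (h₂ i hi).2 (h₃ i hi).1 (h₃ i hi).2
      have hp : 0 ≤ x₁ i * x₃ i := mul_nonneg (h₁ i hi).1 (h₃ i hi).1
      have e : (1 - x₃ i) * X i = x₁ i * x₃ i * ((1 - x₂ i) * (1 - x₃ i)) := by rw [hXdef]; ring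
      rw [e]; exact mul_le_mul_of_nonneg_left hn hp)
  have hC := one_sub_prod_doubleHit_le s x₁ x₃ h₁ h₃
  have hD0 : 0 ≤ ∏ i ∈ s, α i := Finset.prod_nonneg hα
  have hαX : (fun i => α i + X i) = fun i => (1 - x₁ i) * (1 - x₂ i) * (1 - x₃ i) + x₁ i * (1 - x₂ i) * (1 - x₃ i) +
      (1 - x₁ i) * x₂ i * (1 - x₃ i) + (1 - x₁ i) * (1 - x₂ i) * x₃ i + x₁ i * (1 - x₂ i) * x₃ i := by
    funext i; rw [hαdef, hXdef]
  rw [hαX] at key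
  calc (∏ i ∈ s, (1 - x₃ i)) * (∏ i ∈ s, ((1 - x₁ i) * (1 - x₂ i) * (1 - x₃ i) + x₁ i * (1 - x₂ i) * (1 - x₃ i) +
          (1 - x₁ i) * x₂ i * (1 - x₃ i) + (1 - x₁ i) * (1 - x₂ i) * x₃ i + x₁ i * (1 - x₂ i) * x₃ i) - ∏ i ∈ s, α i)
        ≤ (∏ i ∈ s, α i) * (1 - ∏ i ∈ s, (1 - x₁ i * x₃ i)) := key
    _ ≤ (∏ i ∈ s, α i) * ((1 - ∏ i ∈ s, (1 - x₁ i)) * (1 - ∏ i ∈ s, (1 - x₃ i))) := mul_le_mul_of_nonneg_left hC hD0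
    _ = (1 - ∏ i ∈ s, (1 - x₁ i)) * (1 - ∏ i ∈ s, (1 - x₃ i)) * ∏ i ∈ s, α i := by ring

/-- **HI3 for any number of stars**: with `X^i₁₂ = x^i₁x^i₂(1−x^i₃)` and `H_a = 1 − ∏_i(1−x^i_a)`:
`(1 − H₁H₂)·(∏(α_i + X^i₁₂) − ∏α_i) ≤ H₁H₂·∏α_i`, i.e. `(1−H₁H₂)q₁₂ ≤ H₁H₂ q_d` for the m-star world weights.
[cite: KozmaNitzan2024, §3.2 (pp. 12–14) — extension; folklore arithmetic] -/
theorem hairIneq_top_multi [DecidableEq ι] (s : Finset ι) (x₁ x₂ x₃ : ι → ℝ)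
    (h₁ : ∀ i ∈ s, 0 ≤ x₁ i ∧ x₁ i ≤ 1) (h₂ : ∀ i ∈ s, 0 ≤ x₂ i ∧ x₂ i ≤ 1) (h₃ : ∀ i ∈ s, 0 ≤ x₃ i ∧ x₃ i ≤ 1) :
    (1 - (1 - ∏ i ∈ s, (1 - x₁ i)) * (1 - ∏ i ∈ s, (1 - x₂ i))) *
        (∏ i ∈ s, ((1 - x₁ i) * (1 - x₂ i) * (1 - x₃ i) + x₁ i * (1 - x₂ i) * (1 - x₃ i) + (1 - x₁ i) * x₂ i * (1 - x₃ i) +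
              (1 - x₁ i) * (1 - x₂ i) * x₃ i + x₁ i * x₂ i * (1 - x₃ i)) -
          ∏ i ∈ s, ((1 - x₁ i) * (1 - x₂ i) * (1 - x₃ i) + x₁ i * (1 - x₂ i) * (1 - x₃ i) + (1 - x₁ i) * x₂ i * (1 - x₃ i) +
              (1 - x₁ i) * (1 - x₂ i) * x₃ i)) ≤
      (1 - ∏ i ∈ s, (1 - x₁ i)) * (1 - ∏ i ∈ s, (1 - x₂ i)) *
        ∏ i ∈ s, ((1 - x₁ i) * (1 - x₂ i) * (1 - x₃ i) + x₁ i * (1 - x₂ i) * (1 - x₃ i) + (1 - x₁ i) * x₂ i * (1 - x₃ i) +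
            (1 - x₁ i) * (1 - x₂ i) * x₃ i) := by
  set α : ι → ℝ := fun i => (1 - x₁ i) * (1 - x₂ i) * (1 - x₃ i) + x₁ i * (1 - x₂ i) * (1 - x₃ i) + (1 - x₁ i) * x₂ i * (1 - x₃ i) +
    (1 - x₁ i) * (1 - x₂ i) * x₃ i with hαdef
  set X : ι → ℝ := fun i => x₁ i * x₂ i * (1 - x₃ i) with hXdef
  have hα : ∀ i ∈ s, 0 ≤ α i := fun i hi =>
    alpha_nonneg (h₁ i hi).1 (h₁ i hi).2 (h₂ i hi).1 (h₂ i hi).2 (h₃ i hi).1 (h₃ i hi).2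
  have hX : ∀ i ∈ s, 0 ≤ X i := fun i hi => mul_nonneg (mul_nonneg (h₁ i hi).1 (h₂ i hi).1) (by linarith [(h₃ i hi).2])
  have key := prod_absorb_le s α X (fun i => 1 - x₁ i * x₂ i) (fun i => x₁ i * x₂ i) hα hX
    (fun i hi => by nlinarith [(h₁ i hi).2, (h₂ i hi).2, (h₁ i hi).1, (h₂ i hi).1]) (fun i hi => mul_nonneg (h₁ i hi).1 (h₂ i hi).1)
    (fun i hi => le_rfl)
    (fun i hi => absorb12_le_alpha (h₁ i hi).1 (h₁ i hi).2 (h₂ i hi).1 (h₂ i hi).2 (h₃ i hi).1 (h₃ i hi).2)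
    (fun i hi => by
      have hn := noHit3_le_alpha (h₁ i hi).1 (h₁ i hi).2 (h₂ i hi).1 (h₂ i hi).2 (h₃ i hi).1 (h₃ i hi).2
      have hp : 0 ≤ x₁ i * x₂ i := mul_nonneg (h₁ i hi).1 (h₂ i hi).1
      have e : (1 - x₁ i * x₂ i) * X i = x₁ i * x₂ i * ((1 - x₃ i) * (1 - x₁ i * x₂ i)) := by rw [hXdef]; ring
      rw [e]; exact mul_le_mul_of_nonneg_left hn hp)
  have hC := one_sub_prod_doubleHit_le s x₁ x₂ h₁ h₂
  have hD0 : 0 ≤ ∏ i ∈ s, α i := Finset.prod_nonneg hα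
  have hED : ∏ i ∈ s, α i ≤ ∏ i ∈ s, (α i + X i) := Finset.prod_le_prod hα fun i hi => by linarith [hX i hi]
  have hU0 : 0 ≤ ∏ i ∈ s, (1 - x₁ i * x₂ i) :=
    Finset.prod_nonneg fun i hi => by nlinarith [(h₁ i hi).2, (h₂ i hi).2, (h₁ i hi).1, (h₂ i hi).1]
  -- `1 − H₁H₂ ≤ ∏(1 − x₁x₂)` (Claim C rearranged)
  have hC' : 1 - (1 - ∏ i ∈ s, (1 - x₁ i)) * (1 - ∏ i ∈ s, (1 - x₂ i)) ≤ ∏ i ∈ s, (1 - x₁ i * x₂ i) := by linarith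
  have hαX : (fun i => α i + X i) = fun i => (1 - x₁ i) * (1 - x₂ i) * (1 - x₃ i) + x₁ i * (1 - x₂ i) * (1 - x₃ i) +
      (1 - x₁ i) * x₂ i * (1 - x₃ i) + (1 - x₁ i) * (1 - x₂ i) * x₃ i + x₁ i * x₂ i * (1 - x₃ i) := by
    funext i; rw [hαdef, hXdef]
  have hED' : 0 ≤ ∏ i ∈ s, (α i + X i) - ∏ i ∈ s, α i := sub_nonneg.2 hED
  rw [hαX] at key hED'
  calc (1 - (1 - ∏ i ∈ s, (1 - x₁ i)) * (1 - ∏ i ∈ s, (1 - x₂ i))) *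
          (∏ i ∈ s, ((1 - x₁ i) * (1 - x₂ i) * (1 - x₃ i) + x₁ i * (1 - x₂ i) * (1 - x₃ i) +
            (1 - x₁ i) * x₂ i * (1 - x₃ i) + (1 - x₁ i) * (1 - x₂ i) * x₃ i + x₁ i * x₂ i * (1 - x₃ i)) - ∏ i ∈ s, α i)
        ≤ (∏ i ∈ s, (1 - x₁ i * x₂ i)) *
          (∏ i ∈ s, ((1 - x₁ i) * (1 - x₂ i) * (1 - x₃ i) + x₁ i * (1 - x₂ i) * (1 - x₃ i) +
            (1 - x₁ i) * x₂ i * (1 - x₃ i) + (1 - x₁ i) * (1 - x₂ i) * x₃ i + x₁ i * x₂ i * (1 - x₃ i)) - ∏ i ∈ s, α i) :=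
          mul_le_mul_of_nonneg_right hC' hED'
    _ ≤ (∏ i ∈ s, α i) * (1 - ∏ i ∈ s, (1 - x₁ i * x₂ i)) := key
    _ ≤ (∏ i ∈ s, α i) * ((1 - ∏ i ∈ s, (1 - x₁ i)) * (1 - ∏ i ∈ s, (1 - x₂ i))) := mul_le_mul_of_nonneg_left hC hD0
    _ = (1 - ∏ i ∈ s, (1 - x₁ i)) * (1 - ∏ i ∈ s, (1 - x₂ i)) * ∏ i ∈ s, α i := by ring

/-- Degeneracy bound for the middle case, m stars: `(1−H₂)(1−H₃) ≤ q_d`, i.e.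
`(∏(1−x^i₂))·(∏(1−x^i₃)) ≤ ∏ α_i` (every star hanging inside `{1}` lies in the world `d`). [folklore] -/
theorem noHit23_le_qd_multi (s : Finset ι) (x₁ x₂ x₃ : ι → ℝ)
    (h₁ : ∀ i ∈ s, 0 ≤ x₁ i ∧ x₁ i ≤ 1) (h₂ : ∀ i ∈ s, 0 ≤ x₂ i ∧ x₂ i ≤ 1) (h₃ : ∀ i ∈ s, 0 ≤ x₃ i ∧ x₃ i ≤ 1) :
    (∏ i ∈ s, (1 - x₂ i)) * (∏ i ∈ s, (1 - x₃ i)) ≤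
      ∏ i ∈ s, ((1 - x₁ i) * (1 - x₂ i) * (1 - x₃ i) + x₁ i * (1 - x₂ i) * (1 - x₃ i) + (1 - x₁ i) * x₂ i * (1 - x₃ i) +
        (1 - x₁ i) * (1 - x₂ i) * x₃ i) := by
  rw [← Finset.prod_mul_distrib]
  exact Finset.prod_le_prod (fun i hi => mul_nonneg (by linarith [(h₂ i hi).2]) (by linarith [(h₃ i hi).2]))
    fun i hi => noHit_le_alpha (h₁ i hi).1 (h₁ i hi).2 (h₂ i hi).1 (h₂ i hi).2 (h₃ i hi).1 (h₃ i hi).2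

/-- Degeneracy bound for the top case, m stars: `1−H₃ ≤ q_d + q₁₂ = ∏(α_i + X^i₁₂)` (no star touching `3` means the world is `d` or `[12]`).
[folklore] -/
theorem noHit3_le_qd_add_q12_multi (s : Finset ι) (x₁ x₂ x₃ : ι → ℝ)
    (h₁ : ∀ i ∈ s, 0 ≤ x₁ i ∧ x₁ i ≤ 1) (h₂ : ∀ i ∈ s, 0 ≤ x₂ i ∧ x₂ i ≤ 1) (h₃ : ∀ i ∈ s, 0 ≤ x₃ i ∧ x₃ i ≤ 1) :
    ∏ i ∈ s, (1 - x₃ i) ≤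
      ∏ i ∈ s, ((1 - x₁ i) * (1 - x₂ i) * (1 - x₃ i) + x₁ i * (1 - x₂ i) * (1 - x₃ i) + (1 - x₁ i) * x₂ i * (1 - x₃ i) +
        (1 - x₁ i) * (1 - x₂ i) * x₃ i + x₁ i * x₂ i * (1 - x₃ i)) := by
  refine Finset.prod_le_prod (fun i hi => by linarith [(h₃ i hi).2]) fun i hi => ?_
  have e : (1 - x₁ i) * (1 - x₂ i) * (1 - x₃ i) + x₁ i * (1 - x₂ i) * (1 - x₃ i) + (1 - x₁ i) * x₂ i * (1 - x₃ i) +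
      (1 - x₁ i) * (1 - x₂ i) * x₃ i + x₁ i * x₂ i * (1 - x₃ i) - (1 - x₃ i) = x₃ i * (1 - x₁ i) * (1 - x₂ i) := by ring
  have p : 0 ≤ x₃ i * (1 - x₁ i) * (1 - x₂ i) :=
    mul_nonneg (mul_nonneg (h₃ i hi).1 (by linarith [(h₁ i hi).2])) (by linarith [(h₂ i hi).2])
  linarith

end KNGoodGC3Multi

end Summit.CriticalPhenomena.PercolationContinuityZ3.Theorems
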